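import Summits.AtomisticToContinuum.HydrodynamicLimit.Theses.BoxDissipativeWeakStrong
import HarnessLib

/-!
# From convergence in probability to `L¹`: a uniform-integrability lemma for energy-dominated functionals
(crux `FluxClosure`, route `BoxDissipativeWeakStrong`, item stmt-AtomisticToContinuum-9902, line `registered`)

Support lemma of the lead prover (registered helper `tendsto_lintegral_abs_of_dominated_inMeasure`). Both open stubs
of the crux skeleton — kinetic isotropy `KinDev_N → 0` and collisional virial `CollDev_N → 0` — are stated in `L¹(P_N)`,
while sibling routes state the same physics in `P_N`-probability. The landed pathwise bounds
(`FluxClosureVT.abs_kinDev_le`, `abs_collDev_le`) dominate both functionals by `B (1 + e_N)` with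
`e_N = (N+1)⁻¹ Σ_a ‖v_a‖²` the kinetic energy per particle, whose second moments are bounded uniformly in `N` under local
Gibbs laws (Gaussian velocities). This file proves the abstract upgrade: on a sequence of probability spaces, if
`|X_N| ≤ B (1 + e_N)` a.e. with `sup_N E[e_N²] ≤ C` and `X_N → 0` in probability, then `E|X_N| → 0` (ε-splitting and
Cauchy–Schwarz on `{|X_N| > ε}`; no uniform-integrability library is needed across varying spaces). Pure measure theory.
-/

noncomputable section

namespace Summit.AtomisticToContinuum.HydrodynamicLimit.Theorems
namespace FluxClosureUI

open scoped BigOperators Topology Classical MeasureTheory ENNReal NNReal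
open Filter Set Function MeasureTheory

/-- **Energy-dominated convergence in probability implies `L¹` convergence** (registered helper of crux `FluxClosure`).
On probability spaces `(Ω_N, P_N)`: if `X_N`, `e_N` are a.e.-measurable, `e_N ≥ 0` a.e., `|X_N| ≤ B (1 + e_N)` a.e.,
`∫⁻ ofReal (e_N²) dP_N ≤ ofReal C` for all `N`, and `P_N {ε < |X_N|} → 0` for every `ε > 0`, then
`∫⁻ ofReal |X_N| dP_N → 0`. Proof: a.e. `ofReal |X_N| ≤ ofReal ε + 𝟙_S ofReal B + 𝟙_S ofReal (B e_N)` with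
`S = {ε < |X'_N|}` for a measurable modification `X'_N`; integrate, and bound `∫⁻_S ofReal e_N ≤ (P_N S)^{1/2} (ofReal C)^{1/2}`
by Cauchy–Schwarz (`ENNReal.lintegral_mul_le_Lp_mul_Lq`). [folklore] -/
theorem tendsto_lintegral_abs_of_dominated_inMeasure : ∀ {Ω : ℕ → Type*} [∀ N, MeasurableSpace (Ω N)] (P : ∀ N, Measure (Ω N)) [∀ N, IsProbabilityMeasure (P N)] (X e : ∀ N, Ω N → ℝ) (B C : ℝ), 0 ≤ B → 0 ≤ C → (∀ N, AEMeasurable (X N) (P N)) → (∀ N, AEMeasurable (e N) (P N)) → (∀ N, ∀ᵐ z ∂P N, 0 ≤ e N z) → (∀ N, ∀ᵐ z ∂P N, |X N z| ≤ B * (1 + e N z)) → (∀ N, ∫⁻ z, ENNReal.ofReal (e N z ^ 2) ∂P N ≤ ENNReal.ofReal C) → (∀ ε : ℝ, 0 < ε → Tendsto (fun N => P N {z | ε < |X N z|}) atTop (𝓝 0)) → Tendsto (fun N => ∫⁻ z, ENNReal.ofReal |X N z| ∂P N) atTop (𝓝 0) := by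
  intro Ω _ P _ X e B C hB hC hXm hem he0 hXe he2 hX
  rw [ENNReal.tendsto_nhds_zero]
  intro η hη
  rcases eq_or_ne η ⊤ with hηt | hηt
  · exact Eventually.of_forall fun N => hηt ▸ le_top
  have hηpos : 0 < η.toReal := ENNReal.toReal_pos hη.ne' hηt
  set ε : ℝ := η.toReal / 3 with hε
  have hε0 : 0 < ε := by positivity
  have hεη : ENNReal.ofReal ε < η := by
    rw [← ENNReal.ofReal_toReal hηt]
    exact (ENNReal.ofReal_lt_ofReal_iff hηpos).2 (by rw [hε]; linarith)
  -- measurable modifications of `X N` and the (measurable) exceedance sets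
  have hX' : ∀ N, ∃ Y : Ω N → ℝ, Measurable Y ∧ X N =ᵐ[P N] Y := fun N => ⟨(hXm N).mk _, (hXm N).measurable_mk, (hXm N).ae_eq_mk⟩
  choose Y hYm hXY using hX'
  set S : ∀ N, Set (Ω N) := fun N => {z | ε < |Y N z|} with hS
  have hSm : ∀ N, MeasurableSet (S N) := fun N =>
    measurableSet_lt measurable_const (continuous_abs.measurable.comp (hYm N))
  -- the exceedance probabilities tend to zero (transfer from `X` to its modification)
  have hPS : Tendsto (fun N => P N (S N)) atTop (𝓝 0) := by
    refine (hX ε hε0).congr fun N => measure_congr ?_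
    filter_upwards [hXY N] with z hz
    show (ε < |X N z|) = (ε < |Y N z|)
    rw [hz]
  -- the bound sequence and its limit
  set K : ℝ≥0∞ := ENNReal.ofReal B * (ENNReal.ofReal C) ^ (1 / 2 : ℝ) with hK
  have hKt : K ≠ ⊤ := ENNReal.mul_ne_top ENNReal.ofReal_ne_top
    (ENNReal.rpow_ne_top_of_nonneg (by norm_num) ENNReal.ofReal_ne_top)
  set b : ℕ → ℝ≥0∞ := fun N => ENNReal.ofReal ε + ENNReal.ofReal B * P N (S N) + K * (P N (S N)) ^ (1 / 2 : ℝ) with hb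
  have hsqrt : Tendsto (fun N => (P N (S N)) ^ (1 / 2 : ℝ)) atTop (𝓝 0) := by
    have h := ((ENNReal.continuous_rpow_const (y := (1 / 2 : ℝ))).tendsto 0).comp hPS
    rwa [ENNReal.zero_rpow_of_pos (by norm_num : (0 : ℝ) < 1 / 2)] at h
  have hblim : Tendsto b atTop (𝓝 (ENNReal.ofReal ε)) := by
    have h1 : Tendsto (fun N => ENNReal.ofReal B * P N (S N)) atTop (𝓝 0) := by
      simpa using ENNReal.Tendsto.const_mul hPS (Or.inr ENNReal.ofReal_ne_top)
    have h2 : Tendsto (fun N => K * (P N (S N)) ^ (1 / 2 : ℝ)) atTop (𝓝 0) := by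
      simpa using ENNReal.Tendsto.const_mul hsqrt (Or.inr hKt)
    have h := ((tendsto_const_nhds (x := ENNReal.ofReal ε)).add h1).add h2
    simp only [add_zero] at h
    exact h
  have hev : ∀ᶠ N in atTop, b N < η := (tendsto_order.1 hblim).2 η hεη
  filter_upwards [hev] with N hN
  refine le_trans ?_ hN.le
  -- FIX `N`: the pointwise splitting and Cauchy–Schwarz
  have hpt : ∀ᵐ z ∂P N, ENNReal.ofReal |X N z| ≤
      ENNReal.ofReal ε + (S N).indicator (fun _ => ENNReal.ofReal B) z +
        (S N).indicator (fun z => ENNReal.ofReal B * ENNReal.ofReal (e N z)) z := by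
    filter_upwards [hXe N, hXY N, he0 N] with z hz hzY hze
    by_cases hzS : z ∈ S N
    · rw [indicator_of_mem hzS, indicator_of_mem hzS, ← ENNReal.ofReal_mul hB, add_assoc,
        ← ENNReal.ofReal_add hB (mul_nonneg hB hze)]
      refine le_add_left (ENNReal.ofReal_le_ofReal ?_)
      calc |X N z| ≤ B * (1 + e N z) := hz
        _ = B + B * e N z := by ring
    · rw [indicator_of_notMem hzS, indicator_of_notMem hzS, add_zero, add_zero]
      refine ENNReal.ofReal_le_ofReal ?_
      have h : ¬ ε < |Y N z| := hzS
      rw [hzY]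
      exact le_of_not_gt h
  have hCS : ∫⁻ z, (S N).indicator (fun z => ENNReal.ofReal B * ENNReal.ofReal (e N z)) z ∂P N ≤
      K * (P N (S N)) ^ (1 / 2 : ℝ) := by
    have hmeas1 : AEMeasurable ((S N).indicator (fun _ => (1 : ℝ≥0∞))) (P N) :=
      (measurable_const.indicator (hSm N)).aemeasurable
    have hmeas2 : AEMeasurable (fun z => ENNReal.ofReal (e N z)) (P N) := (hem N).ennreal_ofReal
    have hprod : (fun z => (S N).indicator (fun z => ENNReal.ofReal B * ENNReal.ofReal (e N z)) z) =
        fun z => ENNReal.ofReal B * ((S N).indicator (fun _ => (1 : ℝ≥0∞)) z * ENNReal.ofReal (e N z)) := by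
      funext z
      by_cases hzS : z ∈ S N
      · rw [indicator_of_mem hzS, indicator_of_mem hzS, one_mul]
      · rw [indicator_of_notMem hzS, indicator_of_notMem hzS, zero_mul, mul_zero]
    have hmeas12 : AEMeasurable (fun z => (S N).indicator (fun _ => (1 : ℝ≥0∞)) z * ENNReal.ofReal (e N z)) (P N) :=
      hmeas1.mul hmeas2
    rw [hprod, lintegral_const_mul'' _ hmeas12, hK, mul_assoc]
    refine mul_le_mul' le_rfl ?_
    have hpq : (2 : ℝ).HolderConjugate 2 := by
      rw [Real.holderConjugate_iff]; norm_num
    have hH := ENNReal.lintegral_mul_le_Lp_mul_Lq (P N) hpq hmeas1 hmeas2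
    refine hH.trans ?_
    rw [mul_comm]
    refine mul_le_mul' ?_ ?_
    · -- `(∫⁻ (ofReal e)²)^{1/2} ≤ (ofReal C)^{1/2}`
      refine ENNReal.rpow_le_rpow ?_ (by norm_num)
      refine le_trans (lintegral_mono_ae ?_) (he2 N)
      filter_upwards [he0 N] with z hz
      rw [show ((2 : ℝ)) = ((2 : ℕ) : ℝ) by norm_num, ENNReal.rpow_natCast, ← ENNReal.ofReal_pow hz]
    · -- `(∫⁻ 𝟙_S ^ 2)^{1/2} = (P S)^{1/2}`
      refine ENNReal.rpow_le_rpow (le_of_eq ?_) (by norm_num)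
      rw [← lintegral_indicator_one (hSm N)]
      refine lintegral_congr fun z => ?_
      by_cases hzS : z ∈ S N
      · rw [indicator_of_mem hzS, indicator_of_mem hzS, ENNReal.one_rpow, Pi.one_apply]
      · rw [indicator_of_notMem hzS, indicator_of_notMem hzS, ENNReal.zero_rpow_of_pos (by norm_num)]
  calc ∫⁻ z, ENNReal.ofReal |X N z| ∂P N
      ≤ ∫⁻ z, ENNReal.ofReal ε + (S N).indicator (fun _ => ENNReal.ofReal B) z +
          (S N).indicator (fun z => ENNReal.ofReal B * ENNReal.ofReal (e N z)) z ∂P N := lintegral_mono_ae hpt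
    _ = (∫⁻ z, ENNReal.ofReal ε ∂P N) + (∫⁻ z, (S N).indicator (fun _ => ENNReal.ofReal B) z ∂P N) +
          ∫⁻ z, (S N).indicator (fun z => ENNReal.ofReal B * ENNReal.ofReal (e N z)) z ∂P N := by
        have m1 : Measurable fun z => ENNReal.ofReal ε + (S N).indicator (fun _ => ENNReal.ofReal B) z :=
          (measurable_const.indicator (hSm N)).const_add _
        have m0 : Measurable fun _ : Ω N => ENNReal.ofReal ε := measurable_const
        rw [lintegral_add_left m1, lintegral_add_left m0]
    _ ≤ ENNReal.ofReal ε + ENNReal.ofReal B * P N (S N) + K * (P N (S N)) ^ (1 / 2 : ℝ) := by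
        refine add_le_add (add_le_add ?_ ?_) hCS
        · rw [lintegral_const, measure_univ, mul_one]
        · rw [lintegral_indicator_const (hSm N)]
    _ = b N := rfl

end FluxClosureUI
end Summit.AtomisticToContinuum.HydrodynamicLimit.Theorems

end
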